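import Summits.BirchSwinnertonDyer.BirchSwinnertonDyer.Theorems.SignedLowerHalvesSmallImageLowerHalfBothSignsRttCharRoadCurveLevelPoint
import Literature.NumberTheory.GaloisRepresentations.LubinTateSeriesIndependenceField
import Literature.NumberTheory.GaloisRepresentations.LubinTateCharacterLimit
import HarnessLib

/-!
# Route `SignedLowerHalves`, crux L `SmallImageLowerHalfBothSigns` (stmt-BirchSwinnertonDyer-23599), line `rtt_w3` v9 — row J, CURVE SIDE,
# α-half, Stage C2: the LEVEL POINTS `L_n(a) := Φ([a]_{g,f} λ_{n+1}) ∈ VF(F̄)` of the Lubin–Tate division points — additivity,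
# kernel `π^{n+1}`, `p^{n+1}`-torsion, tower compatibility, and the Galois action through the Lubin–Tate character `χ_{−p}`

Hand `bsd-inputs-honda-p1` g18 (α-lane of row J; LEAD `cruxlead-stmt-BirchSwinnertonDyer-23599` g5; character half and the transport
`alphaHalf_of_alphaLoc` / `curveSide_of_alphaLoc` by `bsd-line-slh-p3-w3` g16, `…RttCharRoadCurveCharacter/Assembly/Transport.lean`);
helper `--supports stmt-BirchSwinnertonDyer-23599`; THEOREMS ONLY, no `sorry`; closes nothing; BSD / crux L / JD / J-curve are NOT proved
by this file.

SETTING (as in Stage B `…RttCharRoadCurveTorsion.lean`). `F` a non-archimedean local field with `[Algebra ℚ_p F]`, `q_F = p²`,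
`π := −p = padicIntToInteger F p (−p)` a uniformiser; `V/ℤ_p` with elliptic fibres, `a = 0`, `P = [−p]`; `U := V ⊗ 𝒪_F`, `g = P ⊗ 𝒪_F`,
`F_U = F_g` (`SupersingularFormalGroupLubinTateLocalField`); `VF := (V ⊗ ℚ_p) ⊗ F` (`hVF`); `K_π^{m+1} = ltField π m`, `λ_{m+1} = genPt`,
`[b]_{g,f} λ_{m+1}` the division points of `F_g` (`LubinTateDivisionPointsOfSeries`), `P(t) = ptHom ⟨t⟩` the formal point (Silverman VII.2.2).

* §4 `mk_divisionPt_add` (`⟨[a]λ⟩ + ⟨[b]λ⟩ = ⟨[a+b]λ⟩` in `Ŵ(𝔪)`, the group law of `Ŵ` IS `F_g`), `pow_smul_mk_divisionPt_eq_zero`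
  (`p^{m+1}⟨[b]λ_{m+1}⟩ = 0`), `inclPt_divisionPt` (`[a]_{g,f}λ_{m+1} = [c·a]_{g,f}λ'` in a higher Lubin–Tate field when `λ_{m+1} = [c]_f λ'`),
  ★ `levelPt_inclPt` (tower compatibility of `Φ`), ★ `levelPt_divisionPt_lubinTateChar_mul` (`Φ([χ_π(σ)b]λ) = σ_* Φ([b]λ)`, from Stage B
  `mapPt_restrictNormal_divisionPt` and Stage C1 `levelPt_eq_smul_levelPt`).
* §5 `levelPt_divisionPt_add`, `levelPt_divisionPt_eq_iff` (`L_n(a) = L_n(b) ↔ π^{n+1} ∣ a − b`), `levelPt_divisionPt_zero`,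
  `pow_smul_levelPt_divisionPt` (`p^{n+1} L_n(a) = O`), `levelPt_divisionPt_tower` (`L_m(a) = L_n(c·a)`).
The exhaustion (counting) and the assembly of the level data / `αloc` are Stage C3 `…RttCharRoadCurveLevels.lean`.

TECHNICAL NOTE. The `IsElliptic` instance of `U ⊗ K_π^{m+1}` is passed explicitly (`ptHom (hE := isElliptic_curveOver V _)`) and the higher
level of the tower is a free index `n` (instantiated to `m+1` only through `exists_inclPt_genPt_eq`): a fresh instance search on the literal
`ltField π (m + 1)` in this import closure diverges (`UniformSpace (unitBall (ltField π (m+1)))` via `littleWedderburn`/`Finite` detours).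

References: [LubinTate1965] §1 Thm. 1, §2 Thm. 2 and Cor.; [CasselsFrohlichANT1967] Ch. VI §3.4 Thm. 3, §3.6 Prop. 6; [SilvermanAEC2009]
III.6.4 (b), VII.2.2; [Kobayashi2003] §8 (proof of Thm. 8.4); [KimPark2017] §2.2 Prop. 2.5.
-/

set_option autoImplicit false
-- D-0017: single-problem summit, the namespace repeats the problem name by design.
set_option linter.dupNamespace false
noncomputable section

open scoped Classical
open PowerSeries ValuativeRel WeierstrassCurve Literature.NumberTheory.EllipticCurves
  Literature.NumberTheory.EllipticCurves.FormalGroupChart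
  Literature.NumberTheory.GaloisRepresentations Literature.NumberTheory.GaloisRepresentations.IsNonarchimedeanLocalField
  Literature.NumberTheory.GaloisRepresentations.LubinTate

namespace Summit.BirchSwinnertonDyer.BirchSwinnertonDyer.Theorems.SmallImageRttCharRoad

section Local

variable {p : ℕ} [hp : Fact p.Prime] {F : Type} [Field F] [ValuativeRel F] [TopologicalSpace F] [IsNonarchimedeanLocalField F]
  [Algebra ℚ_[p] F]

-- the normed-field instances on `F` and on the finite subextensions of `F̄` of `LubinTateTorsion.lean` (local instances there)
attribute [local instance] instUniformSpace_literature rk1 nF nE ltCharIsUniformAddGroup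

variable (V : WeierstrassCurve ℤ_[p]) [hE : (V.map PadicInt.Coe.ringHom).IsElliptic] [hEt : (V.map PadicInt.toZMod).IsElliptic]
  (ha : Literature.NumberTheory.EllipticCurves.HasseManin.tr (V.map PadicInt.toZMod) = 0)
  {P : ℤ_[p]⟦X⟧} (hP : P.map PadicInt.Coe.ringHom = (V.map PadicInt.Coe.ringHom).formalExp.subst
    (C ((-(p : ℤ_[p]) : ℤ_[p]) : ℚ_[p]) * (V.map PadicInt.Coe.ringHom).formalLog))
  (hq : residueFieldCard F = p ^ 2)
  (hπ : (valuation F).IsUniformizer ((padicIntToInteger F p (-(p : ℤ_[p])) : 𝒪[F]) : F))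
  {VF : WeierstrassCurve F} (hVF : (V.map PadicInt.Coe.ringHom).map (algebraMap ℚ_[p] F) = VF)


/-! ### §4 The division points `[b]_{g,f} λ_{m+1}`: the group `Ŵ(𝔪_{K_π^{m+1}})`, the tower, and the Galois action read through `Φ` -/

section Division

/-- **`⟨[a]λ⟩ + ⟨[b]λ⟩ = ⟨[a+b]λ⟩` in `Ŵ(𝔪_E)`** (the group law of `U.Pt` is `F_U = F_g`, `ltAdd_evalPt₁_hom_genPt`).
[cite: CasselsFrohlichANT1967, Ch. VI §3.6 Prop. 6 (a)] [cite: LubinTate1965, §1 Thm. 1] -/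
theorem mk_divisionPt_add (m : ℕ) (a b : 𝒪[F]) :
    ((⟨evalPt₁ (maxNilIdeal F (ltField (padicIntToInteger F p (-(p : ℤ_[p]))) m))
          (hom (isLTRing_LTCoeff hπ) (V.isLTSeries_map_padicIntToInteger_of_tr_eq_zero F ha hP hq)
            (isLTSeries_LTCoeff (padicIntToInteger F p (-(p : ℤ_[p])))) (LTCoeff.of F a))
          (constantCoeff_hom _ _ _ _) (genPt hπ m)⟩ :
        (V.map ((LTCoeff.of F : 𝒪[F] →+* LTCoeff F).comp (padicIntToInteger F p))).Pt
          (ballNilIdeal (ltField (padicIntToInteger F p (-(p : ℤ_[p]))) m))) +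
      ⟨evalPt₁ (maxNilIdeal F (ltField (padicIntToInteger F p (-(p : ℤ_[p]))) m))
          (hom (isLTRing_LTCoeff hπ) (V.isLTSeries_map_padicIntToInteger_of_tr_eq_zero F ha hP hq)
            (isLTSeries_LTCoeff (padicIntToInteger F p (-(p : ℤ_[p])))) (LTCoeff.of F b))
          (constantCoeff_hom _ _ _ _) (genPt hπ m)⟩) =
      ⟨evalPt₁ (maxNilIdeal F (ltField (padicIntToInteger F p (-(p : ℤ_[p]))) m))
          (hom (isLTRing_LTCoeff hπ) (V.isLTSeries_map_padicIntToInteger_of_tr_eq_zero F ha hP hq)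
            (isLTSeries_LTCoeff (padicIntToInteger F p (-(p : ℤ_[p])))) (LTCoeff.of F (a + b)))
          (constantCoeff_hom _ _ _ _) (genPt hπ m)⟩ := by
  apply WeierstrassCurve.Pt.ext
  rw [WeierstrassCurve.Pt.val_add, V.toFormalGroup_map_eq_lubinTateFormalGroup_of_tr_eq_zero F ha hP hq hπ]
  exact ltAdd_evalPt₁_hom_genPt hπ m (V.isLTSeries_map_padicIntToInteger_of_tr_eq_zero F ha hP hq) a b

/-- **`p^{m+1} • ⟨[b]λ_{m+1}⟩ = 0` in `Ŵ(𝔪_E)`** (`p^{m+1} = ±π^{m+1}` and `[π^{m+1}]_g [b]λ_{m+1} = 0`).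
[cite: CasselsFrohlichANT1967, Ch. VI §3.6 Prop. 6 (a)] -/
theorem pow_smul_mk_divisionPt_eq_zero (m : ℕ) (b : 𝒪[F]) :
    p ^ (m + 1) • (⟨evalPt₁ (maxNilIdeal F (ltField (padicIntToInteger F p (-(p : ℤ_[p]))) m))
          (hom (isLTRing_LTCoeff hπ) (V.isLTSeries_map_padicIntToInteger_of_tr_eq_zero F ha hP hq)
            (isLTSeries_LTCoeff (padicIntToInteger F p (-(p : ℤ_[p])))) (LTCoeff.of F b))
          (constantCoeff_hom _ _ _ _) (genPt hπ m)⟩ :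
        (V.map ((LTCoeff.of F : 𝒪[F] →+* LTCoeff F).comp (padicIntToInteger F p))).Pt
          (ballNilIdeal (ltField (padicIntToInteger F p (-(p : ℤ_[p]))) m))) = 0 := by
  apply WeierstrassCurve.Pt.ext
  rw [val_nsmul_eq_ltSMul V ha hP hq hπ, WeierstrassCurve.Pt.val_zero]
  change ltSMul (maxNilIdeal F (ltField (padicIntToInteger F p (-(p : ℤ_[p]))) m)) (isLTRing_LTCoeff hπ)
    (V.isLTSeries_map_padicIntToInteger_of_tr_eq_zero F ha hP hq) ((p ^ (m + 1) : ℕ) : LTCoeff F)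
    (evalPt₁ (maxNilIdeal F (ltField (padicIntToInteger F p (-(p : ℤ_[p]))) m))
      (hom (isLTRing_LTCoeff hπ) (V.isLTSeries_map_padicIntToInteger_of_tr_eq_zero F ha hP hq)
        (isLTSeries_LTCoeff (padicIntToInteger F p (-(p : ℤ_[p])))) (LTCoeff.of F b))
      (constantCoeff_hom _ _ _ _) (genPt hπ m)) = 0
  rw [Nat.cast_pow, natCast_eq_neg_ltCoeff, neg_pow, mul_ltSMul, ltSMul_pow_evalPt₁_hom_genPt, ltSMul_zero]

/-- **The tower**: if `λ_{m+1} = [c]_f λ'` in a higher Lubin–Tate field `K' ⊇ K_π^{m+1}` (`λ'` its generator) then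
`[a]_{g,f} λ_{m+1} = [c·a]_{g,f} λ'` there (`inclPt_evalPt₁`, `[a]_{g,f} ∘ [c]_f = [ac]_{g,f}`).  The higher level is a free index `n`
(instantiated to `m + 1` with `exists_inclPt_genPt_eq`): instance search on the literal `ltField π (m + 1)` diverges.
[cite: CasselsFrohlichANT1967, Ch. VI §3.6 Prop. 6 (a)] [cite: LubinTate1965, §1 Thm. 1] -/
theorem inclPt_divisionPt (m n : ℕ)
    (hmn : ltField (padicIntToInteger F p (-(p : ℤ_[p]))) m ≤ ltField (padicIntToInteger F p (-(p : ℤ_[p]))) n) {c : 𝒪[F]}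
    (hc : inclPt hmn (genPt hπ m) = ltAct hπ n c (genPt hπ n)) (a : 𝒪[F]) :
    inclPt hmn
        (evalPt₁ (maxNilIdeal F (ltField (padicIntToInteger F p (-(p : ℤ_[p]))) m))
          (hom (isLTRing_LTCoeff hπ) (V.isLTSeries_map_padicIntToInteger_of_tr_eq_zero F ha hP hq)
            (isLTSeries_LTCoeff (padicIntToInteger F p (-(p : ℤ_[p])))) (LTCoeff.of F a))
          (constantCoeff_hom _ _ _ _) (genPt hπ m)) =
      evalPt₁ (maxNilIdeal F (ltField (padicIntToInteger F p (-(p : ℤ_[p]))) n))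
        (hom (isLTRing_LTCoeff hπ) (V.isLTSeries_map_padicIntToInteger_of_tr_eq_zero F ha hP hq)
          (isLTSeries_LTCoeff (padicIntToInteger F p (-(p : ℤ_[p])))) (LTCoeff.of F (c * a)))
        (constantCoeff_hom _ _ _ _) (genPt hπ n) := by
  rw [inclPt_evalPt₁, hc]
  unfold ltAct ltSMul
  rw [evalPt₁_hom_evalPt₁_hom, ← map_mul, mul_comm]

omit hEt in
include hVF in
/-- ★ **Tower compatibility of `Φ`**: `Φ_{K'}(ι t) = Φ_{K_π^{m+1}}(t)` for `t ∈ 𝔪_{K_π^{m+1}}` and a higher Lubin–Tate field `K' = K_π^{n+1}`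
(same `F̄`-coordinates; the `IsElliptic` instances are supplied explicitly). [cite: SilvermanAEC2009, Prop. VII.2.2] -/
theorem levelPt_inclPt (m n : ℕ)
    (hmn : ltField (padicIntToInteger F p (-(p : ℤ_[p]))) m ≤ ltField (padicIntToInteger F p (-(p : ℤ_[p]))) n)
    (t : (ballNilIdeal (ltField (padicIntToInteger F p (-(p : ℤ_[p]))) m)).toIdeal) :
    Affine.Point.congrEquiv (curveOver_map_algebraMap V hVF (ltField (padicIntToInteger F p (-(p : ℤ_[p]))) n))
        ((curveOver (ltField (padicIntToInteger F p (-(p : ℤ_[p]))) n)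
            (V.map ((LTCoeff.of F : 𝒪[F] →+* LTCoeff F).comp (padicIntToInteger F p)))).mapPointHom
          (algebraMap (ltField (padicIntToInteger F p (-(p : ℤ_[p]))) n) (AlgebraicClosure F))
          (ptHom (hE := isElliptic_curveOver V _) (ltField (padicIntToInteger F p (-(p : ℤ_[p]))) n)
            (V.map ((LTCoeff.of F : 𝒪[F] →+* LTCoeff F).comp (padicIntToInteger F p)))
            ⟨inclPt hmn t⟩)) =
      Affine.Point.congrEquiv (curveOver_map_algebraMap V hVF (ltField (padicIntToInteger F p (-(p : ℤ_[p]))) m))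
        ((curveOver (ltField (padicIntToInteger F p (-(p : ℤ_[p]))) m)
            (V.map ((LTCoeff.of F : 𝒪[F] →+* LTCoeff F).comp (padicIntToInteger F p)))).mapPointHom
          (algebraMap (ltField (padicIntToInteger F p (-(p : ℤ_[p]))) m) (AlgebraicClosure F))
          (ptHom (hE := isElliptic_curveOver V _) (ltField (padicIntToInteger F p (-(p : ℤ_[p]))) m)
            (V.map ((LTCoeff.of F : 𝒪[F] →+* LTCoeff F).comp (padicIntToInteger F p))) ⟨t⟩)) := by
  have e1 : inclPt hmn t = mapBallPt (inclUnitBall hmn) (fun x hx => (inclPt hmn ⟨x, hx⟩).2) t := Subtype.ext rfl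
  have h2 : ((evX (V.map ((LTCoeff.of F : 𝒪[F] →+* LTCoeff F).comp (padicIntToInteger F p))) (inclPt hmn t) :
        ltField (padicIntToInteger F p (-(p : ℤ_[p]))) n) : AlgebraicClosure F) =
      (1 : Field.absoluteGaloisGroup F) •
        ((evX (V.map ((LTCoeff.of F : 𝒪[F] →+* LTCoeff F).comp (padicIntToInteger F p))) t :
          ltField (padicIntToInteger F p (-(p : ℤ_[p]))) m) : AlgebraicClosure F) := by
    have hX := evX_mapBallPt (W := V.map ((LTCoeff.of F : 𝒪[F] →+* LTCoeff F).comp (padicIntToInteger F p)))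
      (inclUnitBall hmn) (continuous_inclUnitBall hmn) (fun x hx => (inclPt hmn ⟨x, hx⟩).2) t
    rw [one_smul, e1, hX, coe_inclUnitBall, IntermediateField.coe_inclusion]
    rfl
  have h1 : ((((inclPt hmn t : (maxNilIdeal F (ltField (padicIntToInteger F p (-(p : ℤ_[p]))) n)).toIdeal) :
      unitBall (ltField (padicIntToInteger F p (-(p : ℤ_[p]))) n)) : ltField (padicIntToInteger F p (-(p : ℤ_[p]))) n) :
        AlgebraicClosure F) =
      (1 : Field.absoluteGaloisGroup F) •
        (((t : unitBall (ltField (padicIntToInteger F p (-(p : ℤ_[p]))) m)) : ltField (padicIntToInteger F p (-(p : ℤ_[p]))) m) :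
          AlgebraicClosure F) := by
    rw [one_smul]; exact coe_inclPt _ t
  have h := levelPt_eq_smul_levelPt (hEK := isElliptic_curveOver V _) V hVF (ltField (padicIntToInteger F p (-(p : ℤ_[p]))) n)
    (ltField (padicIntToInteger F p (-(p : ℤ_[p]))) m) (hEK₁ := isElliptic_curveOver V _) 1 t (inclPt hmn t) h1 h2
  rw [h, map_one, point_map_one]

include hVF in
/-- ★ **Galois on `Φ` of the division points**: `Φ([χ_π(σ) b]λ) = σ • Φ([b]λ)` in `VF(F̄)` (`σ'([b]λ) = [χ_π(σ)b]λ`, Stage B, and the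
`F̄`-coordinates of `Φ` are Galois-covariant). [cite: LubinTate1965, §2 Thm. 2 and Cor.] [cite: SilvermanAEC2009, Prop. VII.2.2] -/
theorem levelPt_divisionPt_lubinTateChar_mul (m : ℕ) (σ : Field.absoluteGaloisGroup F) (b : 𝒪[F]) :
    Affine.Point.congrEquiv (curveOver_map_algebraMap V hVF (ltField (padicIntToInteger F p (-(p : ℤ_[p]))) m))
        ((curveOver (ltField (padicIntToInteger F p (-(p : ℤ_[p]))) m)
            (V.map ((LTCoeff.of F : 𝒪[F] →+* LTCoeff F).comp (padicIntToInteger F p)))).mapPointHom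
          (algebraMap (ltField (padicIntToInteger F p (-(p : ℤ_[p]))) m) (AlgebraicClosure F))
          (ptHom (hE := isElliptic_curveOver V _) (ltField (padicIntToInteger F p (-(p : ℤ_[p]))) m)
            (V.map ((LTCoeff.of F : 𝒪[F] →+* LTCoeff F).comp (padicIntToInteger F p)))
            ⟨evalPt₁ (maxNilIdeal F (ltField (padicIntToInteger F p (-(p : ℤ_[p]))) m))
              (hom (isLTRing_LTCoeff hπ) (V.isLTSeries_map_padicIntToInteger_of_tr_eq_zero F ha hP hq)
                (isLTSeries_LTCoeff (padicIntToInteger F p (-(p : ℤ_[p])))) (LTCoeff.of F ((lubinTateChar hπ σ : 𝒪[F]) * b)))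
              (constantCoeff_hom _ _ _ _) (genPt hπ m)⟩)) =
      Affine.Point.map (W' := VF) ((Field.absoluteGaloisGroup.toAlgEquiv F σ : AlgebraicClosure F ≃ₐ[F] AlgebraicClosure F) :
          AlgebraicClosure F →ₐ[F] AlgebraicClosure F)
        (Affine.Point.congrEquiv (curveOver_map_algebraMap V hVF (ltField (padicIntToInteger F p (-(p : ℤ_[p]))) m))
          ((curveOver (ltField (padicIntToInteger F p (-(p : ℤ_[p]))) m)
              (V.map ((LTCoeff.of F : 𝒪[F] →+* LTCoeff F).comp (padicIntToInteger F p)))).mapPointHom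
            (algebraMap (ltField (padicIntToInteger F p (-(p : ℤ_[p]))) m) (AlgebraicClosure F))
            (ptHom (hE := isElliptic_curveOver V _) (ltField (padicIntToInteger F p (-(p : ℤ_[p]))) m)
              (V.map ((LTCoeff.of F : 𝒪[F] →+* LTCoeff F).comp (padicIntToInteger F p)))
              ⟨evalPt₁ (maxNilIdeal F (ltField (padicIntToInteger F p (-(p : ℤ_[p]))) m))
                (hom (isLTRing_LTCoeff hπ) (V.isLTSeries_map_padicIntToInteger_of_tr_eq_zero F ha hP hq)
                  (isLTSeries_LTCoeff (padicIntToInteger F p (-(p : ℤ_[p])))) (LTCoeff.of F b))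
                (constantCoeff_hom _ _ _ _) (genPt hπ m)⟩))) := by
  haveI := isGalois_ltField hπ m
  have hmap := mapPt_restrictNormal_divisionPt V ha hP hq hπ m σ b
  refine levelPt_eq_smul_levelPt (hEK := isElliptic_curveOver V _) V hVF (ltField (padicIntToInteger F p (-(p : ℤ_[p]))) m)
    (ltField (padicIntToInteger F p (-(p : ℤ_[p]))) m) (hEK₁ := isElliptic_curveOver V _) σ _ _ ?_ ?_
  · exact (absGal_smul_evalPt₁_hom_genPt hπ m (V.isLTSeries_map_padicIntToInteger_of_tr_eq_zero F ha hP hq) σ b).symm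
  · rw [← hmap]
    have e1 : mapPt (AlgEquiv.restrictNormalHom (ltField (padicIntToInteger F p (-(p : ℤ_[p]))) m)
          (Field.absoluteGaloisGroup.toAlgEquiv F σ))
        (evalPt₁ (maxNilIdeal F (ltField (padicIntToInteger F p (-(p : ℤ_[p]))) m))
          (hom (isLTRing_LTCoeff hπ) (V.isLTSeries_map_padicIntToInteger_of_tr_eq_zero F ha hP hq)
            (isLTSeries_LTCoeff (padicIntToInteger F p (-(p : ℤ_[p])))) (LTCoeff.of F b))
          (constantCoeff_hom _ _ _ _) (genPt hπ m)) =
        mapBallPt (toUnitBallHom (AlgEquiv.restrictNormalHom (ltField (padicIntToInteger F p (-(p : ℤ_[p]))) m)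
            (Field.absoluteGaloisGroup.toAlgEquiv F σ)))
          (fun x hx => (mapPt (AlgEquiv.restrictNormalHom (ltField (padicIntToInteger F p (-(p : ℤ_[p]))) m)
            (Field.absoluteGaloisGroup.toAlgEquiv F σ)) ⟨x, hx⟩).2)
          (evalPt₁ (maxNilIdeal F (ltField (padicIntToInteger F p (-(p : ℤ_[p]))) m))
            (hom (isLTRing_LTCoeff hπ) (V.isLTSeries_map_padicIntToInteger_of_tr_eq_zero F ha hP hq)
              (isLTSeries_LTCoeff (padicIntToInteger F p (-(p : ℤ_[p])))) (LTCoeff.of F b))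
            (constantCoeff_hom _ _ _ _) (genPt hπ m)) := Subtype.ext rfl
    have hX := evX_mapBallPt (W := V.map ((LTCoeff.of F : 𝒪[F] →+* LTCoeff F).comp (padicIntToInteger F p)))
      (toUnitBallHom (AlgEquiv.restrictNormalHom (ltField (padicIntToInteger F p (-(p : ℤ_[p]))) m)
        (Field.absoluteGaloisGroup.toAlgEquiv F σ)))
      (continuous_toUnitBallHom _)
      (fun x hx => (mapPt (AlgEquiv.restrictNormalHom (ltField (padicIntToInteger F p (-(p : ℤ_[p]))) m)
        (Field.absoluteGaloisGroup.toAlgEquiv F σ)) ⟨x, hx⟩).2)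
      (evalPt₁ (maxNilIdeal F (ltField (padicIntToInteger F p (-(p : ℤ_[p]))) m))
        (hom (isLTRing_LTCoeff hπ) (V.isLTSeries_map_padicIntToInteger_of_tr_eq_zero F ha hP hq)
          (isLTSeries_LTCoeff (padicIntToInteger F p (-(p : ℤ_[p])))) (LTCoeff.of F b))
        (constantCoeff_hom _ _ _ _) (genPt hπ m))
    rw [e1, hX, coe_toUnitBallHom, Field.absoluteGaloisGroup.smul_def]
    exact AlgEquiv.restrictNormal_commutes (Field.absoluteGaloisGroup.toAlgEquiv F σ)
      (ltField (padicIntToInteger F p (-(p : ℤ_[p]))) m) _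

end Division

/-! ### §5 The level points `L_n(b) := Φ([b]_{g,f} λ_{n+1}) ∈ VF(F̄)`: additivity, kernel, torsion, tower, exhaustion -/

section LevelPoints

include hVF in
/-- **`L_n(a + b) = L_n(a) + L_n(b)`.** [cite: CasselsFrohlichANT1967, Ch. VI §3.6 Prop. 6 (a)] [cite: SilvermanAEC2009, Prop. VII.2.2] -/
theorem levelPt_divisionPt_add (n : ℕ) (a b : 𝒪[F]) :
    Affine.Point.congrEquiv (curveOver_map_algebraMap V hVF (ltField (padicIntToInteger F p (-(p : ℤ_[p]))) n))
        ((curveOver (ltField (padicIntToInteger F p (-(p : ℤ_[p]))) n)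
            (V.map ((LTCoeff.of F : 𝒪[F] →+* LTCoeff F).comp (padicIntToInteger F p)))).mapPointHom
          (algebraMap (ltField (padicIntToInteger F p (-(p : ℤ_[p]))) n) (AlgebraicClosure F))
          (ptHom (hE := isElliptic_curveOver V _) (ltField (padicIntToInteger F p (-(p : ℤ_[p]))) n)
            (V.map ((LTCoeff.of F : 𝒪[F] →+* LTCoeff F).comp (padicIntToInteger F p)))
            ⟨evalPt₁ (maxNilIdeal F (ltField (padicIntToInteger F p (-(p : ℤ_[p]))) n))
              (hom (isLTRing_LTCoeff hπ) (V.isLTSeries_map_padicIntToInteger_of_tr_eq_zero F ha hP hq)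
                (isLTSeries_LTCoeff (padicIntToInteger F p (-(p : ℤ_[p])))) (LTCoeff.of F (a + b)))
              (constantCoeff_hom _ _ _ _) (genPt hπ n)⟩)) =
      Affine.Point.congrEquiv (curveOver_map_algebraMap V hVF (ltField (padicIntToInteger F p (-(p : ℤ_[p]))) n))
        ((curveOver (ltField (padicIntToInteger F p (-(p : ℤ_[p]))) n)
            (V.map ((LTCoeff.of F : 𝒪[F] →+* LTCoeff F).comp (padicIntToInteger F p)))).mapPointHom
          (algebraMap (ltField (padicIntToInteger F p (-(p : ℤ_[p]))) n) (AlgebraicClosure F))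
          (ptHom (hE := isElliptic_curveOver V _) (ltField (padicIntToInteger F p (-(p : ℤ_[p]))) n)
            (V.map ((LTCoeff.of F : 𝒪[F] →+* LTCoeff F).comp (padicIntToInteger F p)))
            ⟨evalPt₁ (maxNilIdeal F (ltField (padicIntToInteger F p (-(p : ℤ_[p]))) n))
              (hom (isLTRing_LTCoeff hπ) (V.isLTSeries_map_padicIntToInteger_of_tr_eq_zero F ha hP hq)
                (isLTSeries_LTCoeff (padicIntToInteger F p (-(p : ℤ_[p])))) (LTCoeff.of F a))
              (constantCoeff_hom _ _ _ _) (genPt hπ n)⟩)) +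
      Affine.Point.congrEquiv (curveOver_map_algebraMap V hVF (ltField (padicIntToInteger F p (-(p : ℤ_[p]))) n))
        ((curveOver (ltField (padicIntToInteger F p (-(p : ℤ_[p]))) n)
            (V.map ((LTCoeff.of F : 𝒪[F] →+* LTCoeff F).comp (padicIntToInteger F p)))).mapPointHom
          (algebraMap (ltField (padicIntToInteger F p (-(p : ℤ_[p]))) n) (AlgebraicClosure F))
          (ptHom (hE := isElliptic_curveOver V _) (ltField (padicIntToInteger F p (-(p : ℤ_[p]))) n)
            (V.map ((LTCoeff.of F : 𝒪[F] →+* LTCoeff F).comp (padicIntToInteger F p)))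
            ⟨evalPt₁ (maxNilIdeal F (ltField (padicIntToInteger F p (-(p : ℤ_[p]))) n))
              (hom (isLTRing_LTCoeff hπ) (V.isLTSeries_map_padicIntToInteger_of_tr_eq_zero F ha hP hq)
                (isLTSeries_LTCoeff (padicIntToInteger F p (-(p : ℤ_[p])))) (LTCoeff.of F b))
              (constantCoeff_hom _ _ _ _) (genPt hπ n)⟩)) := by
  rw [← mk_divisionPt_add V ha hP hq hπ n a b]
  exact levelPt_add (hEK := isElliptic_curveOver V _) V hVF _ _ _

include hVF in
/-- **`L_n(a) = L_n(b) ↔ π^{n+1} ∣ a − b`** (`Φ` injective, `evalPt₁_hom_genPt_eq_iff`). [cite: CasselsFrohlichANT1967, Ch. VI §3.6 Prop. 6 (a)] -/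
theorem levelPt_divisionPt_eq_iff (n : ℕ) (a b : 𝒪[F]) :
    Affine.Point.congrEquiv (curveOver_map_algebraMap V hVF (ltField (padicIntToInteger F p (-(p : ℤ_[p]))) n))
        ((curveOver (ltField (padicIntToInteger F p (-(p : ℤ_[p]))) n)
            (V.map ((LTCoeff.of F : 𝒪[F] →+* LTCoeff F).comp (padicIntToInteger F p)))).mapPointHom
          (algebraMap (ltField (padicIntToInteger F p (-(p : ℤ_[p]))) n) (AlgebraicClosure F))
          (ptHom (hE := isElliptic_curveOver V _) (ltField (padicIntToInteger F p (-(p : ℤ_[p]))) n)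
            (V.map ((LTCoeff.of F : 𝒪[F] →+* LTCoeff F).comp (padicIntToInteger F p)))
            ⟨evalPt₁ (maxNilIdeal F (ltField (padicIntToInteger F p (-(p : ℤ_[p]))) n))
              (hom (isLTRing_LTCoeff hπ) (V.isLTSeries_map_padicIntToInteger_of_tr_eq_zero F ha hP hq)
                (isLTSeries_LTCoeff (padicIntToInteger F p (-(p : ℤ_[p])))) (LTCoeff.of F a))
              (constantCoeff_hom _ _ _ _) (genPt hπ n)⟩)) =
      Affine.Point.congrEquiv (curveOver_map_algebraMap V hVF (ltField (padicIntToInteger F p (-(p : ℤ_[p]))) n))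
        ((curveOver (ltField (padicIntToInteger F p (-(p : ℤ_[p]))) n)
            (V.map ((LTCoeff.of F : 𝒪[F] →+* LTCoeff F).comp (padicIntToInteger F p)))).mapPointHom
          (algebraMap (ltField (padicIntToInteger F p (-(p : ℤ_[p]))) n) (AlgebraicClosure F))
          (ptHom (hE := isElliptic_curveOver V _) (ltField (padicIntToInteger F p (-(p : ℤ_[p]))) n)
            (V.map ((LTCoeff.of F : 𝒪[F] →+* LTCoeff F).comp (padicIntToInteger F p)))
            ⟨evalPt₁ (maxNilIdeal F (ltField (padicIntToInteger F p (-(p : ℤ_[p]))) n))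
              (hom (isLTRing_LTCoeff hπ) (V.isLTSeries_map_padicIntToInteger_of_tr_eq_zero F ha hP hq)
                (isLTSeries_LTCoeff (padicIntToInteger F p (-(p : ℤ_[p])))) (LTCoeff.of F b))
              (constantCoeff_hom _ _ _ _) (genPt hπ n)⟩)) ↔
      (padicIntToInteger F p (-(p : ℤ_[p]))) ^ (n + 1) ∣ a - b := by
  rw [← evalPt₁_hom_genPt_eq_iff hπ n (V.isLTSeries_map_padicIntToInteger_of_tr_eq_zero F ha hP hq)]
  constructor
  · intro h
    exact WeierstrassCurve.Pt.ext_iff.mp (levelPt_injective (hEK := isElliptic_curveOver V _) V hVF _ h)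
  · intro h
    exact congrArg (fun x => Affine.Point.congrEquiv (curveOver_map_algebraMap V hVF (ltField (padicIntToInteger F p (-(p : ℤ_[p]))) n))
        ((curveOver (ltField (padicIntToInteger F p (-(p : ℤ_[p]))) n)
            (V.map ((LTCoeff.of F : 𝒪[F] →+* LTCoeff F).comp (padicIntToInteger F p)))).mapPointHom
          (algebraMap (ltField (padicIntToInteger F p (-(p : ℤ_[p]))) n) (AlgebraicClosure F))
          (ptHom (hE := isElliptic_curveOver V _) (ltField (padicIntToInteger F p (-(p : ℤ_[p]))) n)
            (V.map ((LTCoeff.of F : 𝒪[F] →+* LTCoeff F).comp (padicIntToInteger F p)))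
            ⟨x⟩))) h

include hVF in
/-- **`L_n(0) = O`.** [folklore] -/
theorem levelPt_divisionPt_zero (n : ℕ) :
    Affine.Point.congrEquiv (curveOver_map_algebraMap V hVF (ltField (padicIntToInteger F p (-(p : ℤ_[p]))) n))
        ((curveOver (ltField (padicIntToInteger F p (-(p : ℤ_[p]))) n)
            (V.map ((LTCoeff.of F : 𝒪[F] →+* LTCoeff F).comp (padicIntToInteger F p)))).mapPointHom
          (algebraMap (ltField (padicIntToInteger F p (-(p : ℤ_[p]))) n) (AlgebraicClosure F))
          (ptHom (hE := isElliptic_curveOver V _) (ltField (padicIntToInteger F p (-(p : ℤ_[p]))) n)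
            (V.map ((LTCoeff.of F : 𝒪[F] →+* LTCoeff F).comp (padicIntToInteger F p)))
            ⟨evalPt₁ (maxNilIdeal F (ltField (padicIntToInteger F p (-(p : ℤ_[p]))) n))
              (hom (isLTRing_LTCoeff hπ) (V.isLTSeries_map_padicIntToInteger_of_tr_eq_zero F ha hP hq)
                (isLTSeries_LTCoeff (padicIntToInteger F p (-(p : ℤ_[p])))) (LTCoeff.of F 0))
              (constantCoeff_hom _ _ _ _) (genPt hπ n)⟩)) = 0 := by
  have h := levelPt_divisionPt_add V ha hP hq hπ hVF n 0 0
  rw [add_zero] at h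
  exact left_eq_add.mp h

include hVF in
/-- **`p^{n+1} • L_n(b) = O`**: the level points are `p`-power torsion points of `VF(F̄)`. [cite: CasselsFrohlichANT1967, Ch. VI §3.6 Prop. 6 (a)]
[cite: SilvermanAEC2009, Prop. VII.2.2] -/
theorem pow_smul_levelPt_divisionPt (n : ℕ) (b : 𝒪[F]) :
    p ^ (n + 1) • Affine.Point.congrEquiv (curveOver_map_algebraMap V hVF (ltField (padicIntToInteger F p (-(p : ℤ_[p]))) n))
        ((curveOver (ltField (padicIntToInteger F p (-(p : ℤ_[p]))) n)
            (V.map ((LTCoeff.of F : 𝒪[F] →+* LTCoeff F).comp (padicIntToInteger F p)))).mapPointHom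
          (algebraMap (ltField (padicIntToInteger F p (-(p : ℤ_[p]))) n) (AlgebraicClosure F))
          (ptHom (hE := isElliptic_curveOver V _) (ltField (padicIntToInteger F p (-(p : ℤ_[p]))) n)
            (V.map ((LTCoeff.of F : 𝒪[F] →+* LTCoeff F).comp (padicIntToInteger F p)))
            ⟨evalPt₁ (maxNilIdeal F (ltField (padicIntToInteger F p (-(p : ℤ_[p]))) n))
              (hom (isLTRing_LTCoeff hπ) (V.isLTSeries_map_padicIntToInteger_of_tr_eq_zero F ha hP hq)
                (isLTSeries_LTCoeff (padicIntToInteger F p (-(p : ℤ_[p])))) (LTCoeff.of F b))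
              (constantCoeff_hom _ _ _ _) (genPt hπ n)⟩)) = 0 := by
  rw [← levelPt_nsmul (hEK := isElliptic_curveOver V _) V hVF, pow_smul_mk_divisionPt_eq_zero V ha hP hq hπ n b, map_zero, map_zero,
    map_zero]

include hVF in
/-- **Tower**: with `λ_{m+1} = [c]_f λ'` in a higher Lubin–Tate field (free level index `n`), `L_m(a) = L_n(c·a)`.
[cite: CasselsFrohlichANT1967, Ch. VI §3.6 Prop. 6 (a)] [cite: SilvermanAEC2009, Prop. VII.2.2] -/
theorem levelPt_divisionPt_tower (m n : ℕ)
    (hmn : ltField (padicIntToInteger F p (-(p : ℤ_[p]))) m ≤ ltField (padicIntToInteger F p (-(p : ℤ_[p]))) n) {c : 𝒪[F]}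
    (hc : inclPt hmn (genPt hπ m) = ltAct hπ n c (genPt hπ n)) (a : 𝒪[F]) :
    Affine.Point.congrEquiv (curveOver_map_algebraMap V hVF (ltField (padicIntToInteger F p (-(p : ℤ_[p]))) m))
        ((curveOver (ltField (padicIntToInteger F p (-(p : ℤ_[p]))) m)
            (V.map ((LTCoeff.of F : 𝒪[F] →+* LTCoeff F).comp (padicIntToInteger F p)))).mapPointHom
          (algebraMap (ltField (padicIntToInteger F p (-(p : ℤ_[p]))) m) (AlgebraicClosure F))
          (ptHom (hE := isElliptic_curveOver V _) (ltField (padicIntToInteger F p (-(p : ℤ_[p]))) m)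
            (V.map ((LTCoeff.of F : 𝒪[F] →+* LTCoeff F).comp (padicIntToInteger F p)))
            ⟨evalPt₁ (maxNilIdeal F (ltField (padicIntToInteger F p (-(p : ℤ_[p]))) m))
              (hom (isLTRing_LTCoeff hπ) (V.isLTSeries_map_padicIntToInteger_of_tr_eq_zero F ha hP hq)
                (isLTSeries_LTCoeff (padicIntToInteger F p (-(p : ℤ_[p])))) (LTCoeff.of F a))
              (constantCoeff_hom _ _ _ _) (genPt hπ m)⟩)) =
      Affine.Point.congrEquiv (curveOver_map_algebraMap V hVF (ltField (padicIntToInteger F p (-(p : ℤ_[p]))) n))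
        ((curveOver (ltField (padicIntToInteger F p (-(p : ℤ_[p]))) n)
            (V.map ((LTCoeff.of F : 𝒪[F] →+* LTCoeff F).comp (padicIntToInteger F p)))).mapPointHom
          (algebraMap (ltField (padicIntToInteger F p (-(p : ℤ_[p]))) n) (AlgebraicClosure F))
          (ptHom (hE := isElliptic_curveOver V _) (ltField (padicIntToInteger F p (-(p : ℤ_[p]))) n)
            (V.map ((LTCoeff.of F : 𝒪[F] →+* LTCoeff F).comp (padicIntToInteger F p)))
            ⟨evalPt₁ (maxNilIdeal F (ltField (padicIntToInteger F p (-(p : ℤ_[p]))) n))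
              (hom (isLTRing_LTCoeff hπ) (V.isLTSeries_map_padicIntToInteger_of_tr_eq_zero F ha hP hq)
                (isLTSeries_LTCoeff (padicIntToInteger F p (-(p : ℤ_[p])))) (LTCoeff.of F (c * a)))
              (constantCoeff_hom _ _ _ _) (genPt hπ n)⟩)) := by
  rw [← inclPt_divisionPt V ha hP hq hπ m n hmn hc a]
  exact (levelPt_inclPt V hVF m n hmn _).symm

end LevelPoints

end Local

end Summit.BirchSwinnertonDyer.BirchSwinnertonDyer.Theorems.SmallImageRttCharRoad

end
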